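import Literature.NumberTheory.EllipticCurves.Kato2004.LocalIwasawaCohomologyOrdinaryQuotient
import Literature.NumberTheory.EllipticCurves.Kato2004.LocalIwasawaCohomologyOrdinaryQuotientRank
import Literature.NumberTheory.EllipticCurves.Kato2004.LocalIwasawaCohomologyFiniteness
import Literature.NumberTheory.EllipticCurves.IwasawaAlgebraRankOneIdealProofs
import Literature.NumberTheory.EllipticCurves.IwasawaAlgebraCharIdealProofs
import HarnessLib

/-!
# The ordinary-kernel functional `col : 𝐇¹_{loc,Γ}(T_pW) → Λ` (named fact `exists_ordinaryKernelFunctional`) IS A THEOREM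
# modulo «the ordinary quotient is torsion-free of rank one» + (12.2.3): existence, Kato's finite-cokernel shape (Prop. 17.11),
# and uniqueness up to `Λ` — proofs only

Topic `NumberTheory/EllipticCurves/Kato2004` (namespace = path).  Width seat `cruxlead-stmt-BirchSwinnertonDyer-19573-w3` g8
(cell `pub/bsd-2adic`; crux `OrdKatoHalfAtTwoIso` = item 19573 of `Summits/BirchSwinnertonDyer`, K4 child 24097, line
`steinberg-fibre-at-two`, skeleton v24, cite stub `stub_ordKernelFunctional : exists_ordinaryKernelFunctional`).  Companion of
`LocalIwasawaCohomologyOrdinaryQuotient.lean` (the named fact `exists_ordinaryKernelFunctional`, width seat g5: PRINT-COMPOSITE of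
Perrin-Riou + Kato p. 277 + FOLKLORE LINEAR ALGEBRA) and of `LocalIwasawaCohomologyOrdinaryQuotientRank.lean` (this seat: the
cohomological part alone, `localIwasawaH1_ordinaryQuotient_isTorsionFree_rank_eq_one`: `Q = 𝐇¹_{loc,Γ}(T) ⧸ range(𝐇¹_{loc,Γ}(F⁺T))`
is `Λ`-torsion-free of rank `1`).  THIS FILE proves the folklore linear algebra, i.e. it DERIVES the g5 fact (and more) from the
g8 fact and (12.2.3) (`localIwasawaH1_tateRep_moduleFinite`), using the tree's rank-one module algebra over `Λ = ℤ_p⟦X⟧`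
(`IwasawaAlgebraRankOneIdealProofs.lean`: embedding `Module.exists_injective_linearMap_of_rank_le_one`, saturation
`IwasawaAlgebra.exists_injective_range_not_le_span` (Nakayama), finite index `IwasawaAlgebra.finite_quotient_of_forall_not_le_span`
(`Λ` factorial of dimension two: pseudo-null = finite)).

## What is proved (no definition, no named fact, no instance, no notation; everything a theorem)

§1 MODULE ALGEBRA over `Λ` (generic; `M` finitely generated, `N ≤ M` with `M ⧸ N` torsion-free of rank `1`):
* `exists_functional_ker_eq_of_isTorsionFree_rank_eq_one` — **there is `col : M →ₗ[Λ] Λ` with `ker col = N` EXACTLY, a value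
  outside `(p)`, range of FINITE index in `Λ`, and SATURATED range (contained in no proper principal ideal)** — the reflexive hull
  `M/N ↪ (M/N)^{**} ≅ Λ` in rank one.
* `apply_mul_apply_eq_of_ker_le` — for ANY `col` with `ker col ≤ … = N`-type exactness (`col x = 0 → x ∈ N`) and any `ψ : M →ₗ Λ`
  vanishing on `N`: `col x · ψ y = col y · ψ x` (the element `col x • y − col y • x` lies in `ker col`).
* `exists_unique_eq_smul_of_saturated` — **uniqueness up to `Λ`**: if `col` has kernel `≤ N` and saturated range, every
  `ψ : M →ₗ[Λ] Λ` vanishing on `N` is `λ • col` for a UNIQUE `λ ∈ Λ` (`Hom_Λ(M/N, Λ) = Λ·col`; proof: `p^a ∈ range col`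
  (finite index) and some `col x₂ ∉ (p)`, so `p^a ∣ ψ x₁` where `col x₁ = p^a` by primality of `(p)`, and `ψ = (ψ x₁ / p^a)·col`).
* `notMem_augIdealP_iff_of_normalised` — **choice-freeness of «`μ`-free value»**: for two functionals `ψ₁, ψ₂` vanishing on `N`,
  each with SOME value outside `(p)`, and any `m ∈ M`: `ψ₁ m ∉ (p) ↔ ψ₂ m ∉ (p)` (both are `λᵢ • col` with `λᵢ ∉ (p)`, `(p)` prime).
§2 THE DOORS on Kato's pinned carriers (`J`, `J′` at a good ordinary `v ∣ p`, every `p`; binders VERBATIM those of the g5 fact):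
* `exists_ordinaryKernelFunctional_of_moduleFinite_of_ordinaryQuotientRank` —
  **`localIwasawaH1_tateRep_moduleFinite → localIwasawaH1_ordinaryQuotient_isTorsionFree_rank_eq_one → exists_ordinaryKernelFunctional`**.
* `exists_saturated_ordinaryKernelFunctional_of_moduleFinite_of_ordinaryQuotientRank` — the same with the FINITE-COKERNEL and
  SATURATION clauses (the shape of Kato's Prop. 17.11: «injective and its cokernel is a finite group», there for `p ∤ 6` via
  Coleman's (17.12.1); here at every `p` from the structure fact).
* `ordinaryKernelFunctional_notMem_iff_of_moduleFinite_of_ordinaryQuotientRank` — on the pinned carriers, «`col (x) ∉ (p)`» does not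
  depend on the normalised ordinary-kernel functional `col` (consumer: the line's V♭⁻ stub quantifies over ALL such `col`; by this
  theorem `∀ col` and `∃ col` readings agree).
§3 «KERNEL INSIDE `N`» IS «KERNEL EQUAL TO `N`» (generic, any commutative domain `R`, only `rank (M ⧸ N) = 1` used):
* `apply_eq_zero_of_mem_of_ker_le_of_rank_quotient_eq_one` — a functional `M → R` with `ker ≤ N` kills `N` (rank–nullity: `N ⧸ ker`
  is torsion inside `M ⧸ ker ↪ R`); `notMem_augIdealP_iff_of_ker_le` — choice-freeness for functionals with `ker ≤ N`; on the pinned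
  carriers `ordinaryKernelFunctional_apply_ordinaryInclusion_eq_zero_of_ker_le` (structure fact alone) and
  `ordinaryKernelFunctional_notMem_iff_of_ker_le_of_moduleFinite_of_ordinaryQuotientRank` — so the `∃ col, ker col ≤ range …` texts
  V∓ of p727025 and the `∀ col` registered texts V♭∓ are EQUIVALENT modulo the two facts (Summits-side door of the same seat).

HONEST FRAMING: the two hypotheses are NAMED FACTS (declared debt: (12.2.3) `localIwasawaH1_tateRep_moduleFinite`, conv-1 GEN 27;
`localIwasawaH1_ordinaryQuotient_isTorsionFree_rank_eq_one`, this seat) — every door is CONDITIONAL on them and says so in its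
signature; NET for the consumer: the cite stub `exists_ordinaryKernelFunctional` (one PRINT-COMPOSITE fact with a folklore
linear-algebra clause) becomes a theorem modulo two print-closer facts, and gains the finite-cokernel / uniqueness clauses it
deliberately did not assert.  Nothing about Coleman maps, `p`-adic `L`-functions, the crux or BSD is proved here.

## References
* [Kato2004Asterisque] K. Kato, Astérisque 295 (2004), Prop. 17.11 and its proof (p. 277), §13.14 (p. 234) (reflexive hulls),
  §12.2 (12.2.3) (p. 220).
* [PerrinRiou2000JAMS] §1.1 (p. 537); [LeiLoefflerZerbes2014] App. A.2; [GreenbergLNM1716] §2 Lemma 2.3, pp. 77–79 (the inputs of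
  the structure fact — see `LocalIwasawaCohomologyOrdinaryQuotientRank.lean`).
* [BourbakiAC5to7] N. Bourbaki, *Algèbre commutative* VII §4 nos. 1–2 (torsion-free modules of rank one over a Krull domain;
  reflexive hull); [Washington1997] §13.2 (Nakayama for `Λ`-modules); [NeukirchSchmidtWingberg2008] (5.1.4) Remark 4.
-/

open scoped NumberField
open Field IsDedekindDomain WeierstrassCurve
open Literature.NumberTheory.GaloisRepresentations
open Literature.NumberTheory.EllipticCurves
open Literature.NumberTheory.EllipticCurves.Kato2004 Literature.NumberTheory.EllipticCurves.Kato2004.EulerSystemValues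

namespace Literature.NumberTheory.EllipticCurves.Kato2004

/-! ## §1 Module algebra over `Λ = ℤ_p⟦X⟧` -/

section ModuleAlgebra

variable {p : ℕ} [Fact p.Prime]
variable {M : Type*} [AddCommGroup M] [Module (IwasawaAlgebra p) M]

/-- **A finitely generated `Λ`-module `M` with a submodule `N` such that `M ⧸ N` is torsion-free of rank one carries a
functional `col : M → Λ` with kernel EXACTLY `N`, a value outside `(p)`, range of FINITE index, and SATURATED range**
(contained in no proper principal ideal).  Proof: `M ⧸ N ↪ Λ` (`Module.exists_injective_linearMap_of_rank_le_one`), saturate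
(`IwasawaAlgebra.exists_injective_range_not_le_span`, Nakayama), finite index (`finite_quotient_of_forall_not_le_span`: `Λ` is
factorial of dimension two), compose with `M ↠ M ⧸ N`; the value outside `(p)` is saturation at the non-unit `π = p`.  This is
the reflexive hull `Q ↪ Q^{**} ≅ Λ` of a rank-one torsion-free module (Bourbaki AC VII §4 no. 2; Kato 13.14).
[cite: BourbakiAC5to7, Ch. VII §4 nos. 1–2] [cite: Kato2004Asterisque, 13.14 (p. 234)] -/
theorem exists_functional_ker_eq_of_isTorsionFree_rank_eq_one [Module.Finite (IwasawaAlgebra p) M]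
    (N : Submodule (IwasawaAlgebra p) M) [Module.IsTorsionFree (IwasawaAlgebra p) (M ⧸ N)]
    (hrk : Module.rank (IwasawaAlgebra p) (M ⧸ N) = 1) :
    ∃ col : M →ₗ[IwasawaAlgebra p] IwasawaAlgebra p,
      (∀ x : M, col x = 0 ↔ x ∈ N) ∧ (∃ x : M, col x ∉ IwasawaAlgebra.augIdealP p) ∧
        Finite (IwasawaAlgebra p ⧸ LinearMap.range col) ∧
        (∀ π : IwasawaAlgebra p, ¬ IsUnit π → ¬ (LinearMap.range col ≤ Ideal.span {π})) := by
  haveI : Nontrivial (M ⧸ N) := by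
    by_contra hnt
    rw [not_nontrivial_iff_subsingleton] at hnt
    have h0 : Module.rank (IwasawaAlgebra p) (M ⧸ N) = 0 := rank_subsingleton' _ _
    rw [hrk] at h0
    exact one_ne_zero h0
  obtain ⟨φ₀, hφ₀⟩ :=
    Module.exists_injective_linearMap_of_rank_le_one (R := IwasawaAlgebra p) (M := M ⧸ N) hrk.le
  obtain ⟨φ, hφ, hsat⟩ := IwasawaAlgebra.exists_injective_range_not_le_span φ₀ hφ₀
  have hrange : LinearMap.range (φ ∘ₗ N.mkQ) = LinearMap.range φ :=
    LinearMap.range_comp_of_range_eq_top _ (Submodule.range_mkQ N)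
  have hne : LinearMap.range φ ≠ ⊥ := fun hbot =>
    hsat _ (IwasawaAlgebra.prime_C p).not_unit (hbot ▸ bot_le)
  refine ⟨φ ∘ₗ N.mkQ, fun x => ?_, ?_, ?_, fun π hπ => ?_⟩
  · rw [LinearMap.comp_apply, map_eq_zero_iff φ hφ, Submodule.mkQ_apply, Submodule.Quotient.mk_eq_zero]
  · obtain ⟨y, hy, hyp⟩ := SetLike.not_le_iff_exists.mp (hsat _ (IwasawaAlgebra.prime_C p).not_unit)
    rw [← hrange] at hy
    obtain ⟨x, rfl⟩ := hy
    exact ⟨x, hyp⟩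
  · rw [hrange]
    exact IwasawaAlgebra.finite_quotient_of_forall_not_le_span _ hne hsat
  · rw [hrange]
    exact hsat π hπ

/-- For a functional `col : M → Λ` whose kernel lies in `N` and any functional `ψ` vanishing on `N`:
`col x · ψ y = col y · ψ x` for all `x, y` — the element `col x • y − col y • x` is killed by `col`, hence lies in `N`,
hence is killed by `ψ`. [cite: BourbakiAC5to7, Ch. VII §4 no. 1] -/
theorem apply_mul_apply_eq_of_ker_le (N : Submodule (IwasawaAlgebra p) M)
    (col : M →ₗ[IwasawaAlgebra p] IwasawaAlgebra p) (hker : ∀ x : M, col x = 0 → x ∈ N)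
    (ψ : M →ₗ[IwasawaAlgebra p] IwasawaAlgebra p) (hψ : ∀ x ∈ N, ψ x = 0) (x y : M) :
    col x * ψ y = col y * ψ x := by
  have hmem : col x • y - col y • x ∈ N := hker _ (by
    rw [map_sub, map_smul, map_smul, smul_eq_mul, smul_eq_mul, mul_comm (col x) (col y), sub_self])
  have h := hψ _ hmem
  rw [map_sub, map_smul, map_smul, smul_eq_mul, smul_eq_mul, sub_eq_zero] at h
  exact h

/-- **Uniqueness up to `Λ` (`Hom_Λ(M/N, Λ)` is free of rank one on a saturated functional).**  Let `col : M → Λ` have kernel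
`≤ N` and SATURATED range (in no proper principal ideal).  Then every `Λ`-linear `ψ : M → Λ` vanishing on `N` is `λ • col`
for a UNIQUE `λ ∈ Λ`.  Proof: the range of `col` is a non-zero ideal of finite index (`finite_quotient_of_forall_not_le_span`),
so it contains `p^a` (`exists_natCast_pow_mem_of_finite_quotient`), say `col x₁ = p^a`, and some `col x₂ ∉ (p)` (saturation
at `π = p`); from `col x₂ · ψ x₁ = p^a · ψ x₂` and primality of `p ∈ Λ`, `p^a ∣ ψ x₁`, `ψ x₁ = p^a λ`, and then
`p^a ψ x = col x · ψ x₁ = p^a λ col x` for every `x`; `Λ` is a domain.  Uniqueness: `col x₂ ≠ 0`.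
[cite: BourbakiAC5to7, Ch. VII §4 no. 2] [cite: Kato2004Asterisque, 13.14 (p. 234)] -/
theorem exists_unique_eq_smul_of_saturated (N : Submodule (IwasawaAlgebra p) M)
    (col : M →ₗ[IwasawaAlgebra p] IwasawaAlgebra p) (hker : ∀ x : M, col x = 0 → x ∈ N)
    (hsat : ∀ π : IwasawaAlgebra p, ¬ IsUnit π → ¬ (LinearMap.range col ≤ Ideal.span {π}))
    (ψ : M →ₗ[IwasawaAlgebra p] IwasawaAlgebra p) (hψ : ∀ x ∈ N, ψ x = 0) :
    ∃! c : IwasawaAlgebra p, ψ = c • col := by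
  set π : IwasawaAlgebra p := PowerSeries.C (p : ℤ_[p]) with hπ_def
  have hπprime : Prime π := IwasawaAlgebra.prime_C p
  have hne : LinearMap.range col ≠ ⊥ := fun hbot =>
    hsat _ (IwasawaAlgebra.prime_C p).not_unit (hbot ▸ bot_le)
  haveI : Finite (IwasawaAlgebra p ⧸ LinearMap.range col) :=
    IwasawaAlgebra.finite_quotient_of_forall_not_le_span _ hne hsat
  -- `p^a ∈ range col`
  obtain ⟨a, ha⟩ := IwasawaAlgebra.exists_natCast_pow_mem_of_finite_quotient (p := p) (LinearMap.range col)
  rw [← map_natCast (PowerSeries.C (R := ℤ_[p])) p, ← hπ_def] at ha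
  obtain ⟨x₁, hx₁⟩ := ha
  -- some value outside `(p)`
  obtain ⟨y₂, hy₂, hy₂p⟩ := SetLike.not_le_iff_exists.mp (hsat _ (IwasawaAlgebra.prime_C p).not_unit)
  obtain ⟨x₂, rfl⟩ := hy₂
  have hx₂p : ¬ π ∣ col x₂ := fun h => hy₂p (Ideal.mem_span_singleton.mpr h)
  -- `p^a ∣ ψ x₁`
  have hkey := apply_mul_apply_eq_of_ker_le N col hker ψ hψ
  have hdvd : π ^ a ∣ ψ x₁ := by
    refine hπprime.pow_dvd_of_dvd_mul_left a hx₂p ?_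
    rw [hkey x₂ x₁, hx₁]
    exact dvd_mul_right _ _
  obtain ⟨c, hc⟩ := hdvd
  have hπa : π ^ a ≠ 0 := pow_ne_zero a hπprime.ne_zero
  refine ⟨c, ?_, fun c' hc' => ?_⟩
  · refine LinearMap.ext fun x => ?_
    rw [LinearMap.smul_apply, smul_eq_mul]
    have h := hkey x₁ x
    rw [hx₁, hc] at h
    -- `π^a * ψ x = col x * (π^a * c)`
    rw [mul_comm (col x), mul_assoc] at h
    exact mul_left_cancel₀ hπa h
  · have h₂ : c' * col x₂ = c * col x₂ := by
      have h := congrArg (fun f : M →ₗ[IwasawaAlgebra p] IwasawaAlgebra p => f x₂) hc'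
      have h' : ψ x₂ = c * col x₂ := by
        have hx := hkey x₁ x₂
        rw [hx₁, hc, mul_comm (col x₂), mul_assoc] at hx
        exact mul_left_cancel₀ hπa hx
      simp only [LinearMap.smul_apply, smul_eq_mul] at h
      rw [← h, ← h']
    have hx₂0 : col x₂ ≠ 0 := fun h0 => hx₂p (h0 ▸ dvd_zero π)
    exact mul_right_cancel₀ hx₂0 h₂

/-- **Choice-freeness of «`μ`-free value».**  Let `M` be finitely generated with `M ⧸ N` torsion-free of rank one.  For ANY
two `Λ`-linear functionals `ψ₁, ψ₂ : M → Λ` vanishing on `N`, each taking SOME value outside `(p)`, and any `m ∈ M`: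
`ψ₁ m ∉ (p) ↔ ψ₂ m ∉ (p)`.  (Both are `λᵢ • col` for the saturated functional `col`, with `λᵢ ∉ (p)`; `(p)` is prime.)
Consumer: the value clause of a normalised ordinary-kernel functional at a class does not depend on the functional.
[cite: BourbakiAC5to7, Ch. VII §4 no. 2] [cite: Washington1997, §13.1] -/
theorem notMem_augIdealP_iff_of_normalised [Module.Finite (IwasawaAlgebra p) M]
    (N : Submodule (IwasawaAlgebra p) M) [Module.IsTorsionFree (IwasawaAlgebra p) (M ⧸ N)]
    (hrk : Module.rank (IwasawaAlgebra p) (M ⧸ N) = 1)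
    (ψ₁ ψ₂ : M →ₗ[IwasawaAlgebra p] IwasawaAlgebra p)
    (h₁ : ∀ x ∈ N, ψ₁ x = 0) (h₁' : ∃ x : M, ψ₁ x ∉ IwasawaAlgebra.augIdealP p)
    (h₂ : ∀ x ∈ N, ψ₂ x = 0) (h₂' : ∃ x : M, ψ₂ x ∉ IwasawaAlgebra.augIdealP p) (m : M) :
    ψ₁ m ∉ IwasawaAlgebra.augIdealP p ↔ ψ₂ m ∉ IwasawaAlgebra.augIdealP p := by
  obtain ⟨col, hker, -, -, hsat⟩ := exists_functional_ker_eq_of_isTorsionFree_rank_eq_one N hrk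
  have hker' : ∀ x : M, col x = 0 → x ∈ N := fun x hx => (hker x).mp hx
  have hprime : (IwasawaAlgebra.augIdealP p).IsPrime := IwasawaAlgebra.isPrime_augIdealP_holds p
  -- each normalised `ψᵢ` is `λᵢ • col` with `λᵢ ∉ (p)`, so `ψᵢ m ∉ (p) ↔ col m ∉ (p)`
  have key : ∀ ψ : M →ₗ[IwasawaAlgebra p] IwasawaAlgebra p, (∀ x ∈ N, ψ x = 0) →
      (∃ x : M, ψ x ∉ IwasawaAlgebra.augIdealP p) →
      (ψ m ∉ IwasawaAlgebra.augIdealP p ↔ col m ∉ IwasawaAlgebra.augIdealP p) := by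
    intro ψ hψ hψ'
    obtain ⟨c, hc, -⟩ := exists_unique_eq_smul_of_saturated N col hker' hsat ψ hψ
    obtain ⟨x, hx⟩ := hψ'
    have hcp : c ∉ IwasawaAlgebra.augIdealP p := fun hcp => hx (by
      rw [hc, LinearMap.smul_apply, smul_eq_mul]
      exact Ideal.mul_mem_right _ _ hcp)
    rw [hc, LinearMap.smul_apply, smul_eq_mul, not_iff_not]
    refine ⟨fun h => (hprime.mem_or_mem h).resolve_left hcp, fun h => Ideal.mul_mem_left _ _ h⟩
  rw [key ψ₁ h₁ h₁', key ψ₂ h₂ h₂']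

end ModuleAlgebra

/-! ## §2 The doors on Kato's pinned carriers -/

/-- **`exists_ordinaryKernelFunctional` is a THEOREM modulo (12.2.3) and the structure fact**: for every prime `p`, every
`W/ℚ` good ordinary at `p` and all pinned carriers `J`, `J′`, the ordinary quotient `Q = J.H ⧸ range(J′.ordinaryInclusion J)`
is finitely generated ((12.2.3), `localIwasawaH1_tateRep_moduleFinite`: `J.H` is), torsion-free of rank one
(`localIwasawaH1_ordinaryQuotient_isTorsionFree_rank_eq_one`), hence embeds in `Λ` with saturated image (§1), which is a
NORMALISED functional `col` with kernel EXACTLY `range(J′ → J)`.  CONDITIONAL on the two named facts (hypotheses).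
[cite: Kato2004Asterisque, Prop. 17.11 with proof (p. 277), §12.2 (12.2.3) (p. 220)] [cite: PerrinRiou2000JAMS, §1.1 (p. 537)]
[cite: BourbakiAC5to7, Ch. VII §4 nos. 1–2] -/
theorem exists_ordinaryKernelFunctional_of_moduleFinite_of_ordinaryQuotientRank
    (hfin : localIwasawaH1_tateRep_moduleFinite)
    (hQ : localIwasawaH1_ordinaryQuotient_isTorsionFree_rank_eq_one) :
    exists_ordinaryKernelFunctional := by
  intro p _ W _ _ _ κ v γᵥ hκ hv hord hγᵥ J J'
  haveI := hfin W p κ v γᵥ hκ hv hγᵥ J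
  obtain ⟨htf, hrk⟩ := hQ p W κ v γᵥ hκ hv hord hγᵥ J J'
  haveI := htf
  obtain ⟨col, hker, hval, -, -⟩ :=
    exists_functional_ker_eq_of_isTorsionFree_rank_eq_one (LinearMap.range (J'.ordinaryInclusion J)) hrk
  exact ⟨col, hker, hval⟩

/-- **The finite-cokernel, saturated ordinary-kernel functional (the shape of Kato's Prop. 17.11)**, modulo (12.2.3) and the
structure fact: on all pinned carriers at a good ordinary `v ∣ p` (every `p`) there is `col : 𝐇¹_{loc,Γ}(T_pW) → Λ` with kernel
EXACTLY `range(𝐇¹_{loc,Γ}(F⁺T) → 𝐇¹_{loc,Γ}(T))`, a value outside `(p)`, range of FINITE index («its cokernel is a finite group»,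
Kato p. 277 — there for `p ∤ 6` through Coleman's `𝔏_η`; here at every `p` from the structure of `Q`), and saturated range.
[cite: Kato2004Asterisque, Prop. 17.11 with proof (p. 277), 13.14 (p. 234)] [cite: BourbakiAC5to7, Ch. VII §4 no. 2] -/
theorem exists_saturated_ordinaryKernelFunctional_of_moduleFinite_of_ordinaryQuotientRank
    (hfin : localIwasawaH1_tateRep_moduleFinite)
    (hQ : localIwasawaH1_ordinaryQuotient_isTorsionFree_rank_eq_one) :
    ∀ (p : ℕ) [Fact p.Prime] (W : WeierstrassCurve ℚ) [W.IsElliptic] [W.IsGloballyMinimal]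
      [ContinuousSMul ℤ_[p] (W.tateModule p)]
      (κ : ZpExtension ℚ p) (v : HeightOneSpectrum (𝓞 ℚ)) (γᵥ : absoluteGaloisGroup (v.adicCompletion ℚ)),
      κ.IsCyclotomic → ((p : ℕ) : 𝓞 ℚ) ∈ v.asIdeal → IsOrdinaryAt W p →
      κ.IsTopGenerator (resGalOfEmb (closureEmb (K := ℚ) (v.adicCompletion ℚ)) γᵥ) →
      ∀ (J : LocalIwasawaH1Data κ v ((tateRep W p).toLocal v) γᵥ)
        (J' : LocalIwasawaH1Data κ v (tateLocalOrdinaryRep W p v) γᵥ),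
      ∃ col : J.H →ₗ[IwasawaAlgebra p] IwasawaAlgebra p,
        (∀ x : J.H, col x = 0 ↔ x ∈ LinearMap.range (J'.ordinaryInclusion J)) ∧
          (∃ x : J.H, col x ∉ IwasawaAlgebra.augIdealP p) ∧
          Finite (IwasawaAlgebra p ⧸ LinearMap.range col) ∧
          (∀ π : IwasawaAlgebra p, ¬ IsUnit π → ¬ (LinearMap.range col ≤ Ideal.span {π})) := by
  intro p _ W _ _ _ κ v γᵥ hκ hv hord hγᵥ J J'
  haveI := hfin W p κ v γᵥ hκ hv hγᵥ J
  obtain ⟨htf, hrk⟩ := hQ p W κ v γᵥ hκ hv hord hγᵥ J J'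
  haveI := htf
  exact exists_functional_ker_eq_of_isTorsionFree_rank_eq_one (LinearMap.range (J'.ordinaryInclusion J)) hrk

/-- **«`col x ∉ (p)`» does not depend on the normalised ordinary-kernel functional `col`** (modulo (12.2.3) and the structure
fact): on all pinned carriers at a good ordinary `v ∣ p`, for any two `Λ`-linear `col₁, col₂ : 𝐇¹_{loc,Γ}(T_pW) → Λ` each
vanishing on `range(𝐇¹_{loc,Γ}(F⁺T))` and each with some value outside `(p)`, and every class `x`: `col₁ x ∉ (p) ↔ col₂ x ∉ (p)`.
So the line's stub «every normalised exact-kernel functional takes a value `∉ (p)` at `loc_v` of some genuine class» is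
equivalent to its `∃ col` reading (given one such class serves all functionals — which this theorem provides).
[cite: Kato2004Asterisque, Prop. 17.11 (p. 277)] [cite: BourbakiAC5to7, Ch. VII §4 no. 2] -/
theorem ordinaryKernelFunctional_notMem_iff_of_moduleFinite_of_ordinaryQuotientRank
    (hfin : localIwasawaH1_tateRep_moduleFinite)
    (hQ : localIwasawaH1_ordinaryQuotient_isTorsionFree_rank_eq_one)
    {p : ℕ} [Fact p.Prime] (W : WeierstrassCurve ℚ) [W.IsElliptic] [W.IsGloballyMinimal]
    [ContinuousSMul ℤ_[p] (W.tateModule p)]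
    {κ : ZpExtension ℚ p} {v : HeightOneSpectrum (𝓞 ℚ)} {γᵥ : absoluteGaloisGroup (v.adicCompletion ℚ)}
    (hκ : κ.IsCyclotomic) (hv : ((p : ℕ) : 𝓞 ℚ) ∈ v.asIdeal) (hord : IsOrdinaryAt W p)
    (hγᵥ : κ.IsTopGenerator (resGalOfEmb (closureEmb (K := ℚ) (v.adicCompletion ℚ)) γᵥ))
    (J : LocalIwasawaH1Data κ v ((tateRep W p).toLocal v) γᵥ)
    (J' : LocalIwasawaH1Data κ v (tateLocalOrdinaryRep W p v) γᵥ)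
    (col₁ col₂ : J.H →ₗ[IwasawaAlgebra p] IwasawaAlgebra p)
    (h₁ : ∀ y : J'.H, col₁ (J'.ordinaryInclusion J y) = 0) (h₁' : ∃ x : J.H, col₁ x ∉ IwasawaAlgebra.augIdealP p)
    (h₂ : ∀ y : J'.H, col₂ (J'.ordinaryInclusion J y) = 0) (h₂' : ∃ x : J.H, col₂ x ∉ IwasawaAlgebra.augIdealP p)
    (x : J.H) :
    col₁ x ∉ IwasawaAlgebra.augIdealP p ↔ col₂ x ∉ IwasawaAlgebra.augIdealP p := by
  haveI := hfin W p κ v γᵥ hκ hv hγᵥ J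
  obtain ⟨htf, hrk⟩ := hQ p W κ v γᵥ hκ hv hord hγᵥ J J'
  haveI := htf
  refine notMem_augIdealP_iff_of_normalised (LinearMap.range (J'.ordinaryInclusion J)) hrk col₁ col₂
    ?_ h₁' ?_ h₂' x
  · rintro _ ⟨y, rfl⟩
    exact h₁ y
  · rintro _ ⟨y, rfl⟩
    exact h₂ y

/-! ## §3 «kernel inside `N`» = «kernel equal to `N`» when `rank (M ⧸ N) = 1`; read on the pinned carriers: the `∃ col, ker col ≤
range(𝐇¹_{loc,Γ}(F⁺T))` texts (p727025's V∓/W2∓) and the `∀ col` texts V♭∓ agree modulo (12.2.3) + the structure fact -/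

/-- **A functional whose kernel lies inside `N` kills `N`, as soon as `M ⧸ N` has rank one** (any commutative domain `R`, any
module `M`).  Rank–nullity: with `K = ker col ≤ N`, `M ⧸ K ↪ R` has rank `≤ 1` and `(M ⧸ K) ⧸ (N ⧸ K) ≅ M ⧸ N` has rank `1`,
so `N ⧸ K` has rank `0`, i.e. is torsion — inside `M ⧸ K ↪ R`, hence zero. [cite: BourbakiAC5to7, Ch. VII §4 no. 1] -/
theorem apply_eq_zero_of_mem_of_ker_le_of_rank_quotient_eq_one {R : Type*} [CommRing R] [IsDomain R]
    {M : Type*} [AddCommGroup M] [Module R M] (N : Submodule R M) (hrk : Module.rank R (M ⧸ N) = 1)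
    (col : M →ₗ[R] R) (hker : ∀ x : M, col x = 0 → x ∈ N) : ∀ x ∈ N, col x = 0 := by
  set K := LinearMap.ker col with hK
  have hKN : K ≤ N := fun x hx => hker x (LinearMap.mem_ker.mp hx)
  have hinj : Function.Injective (K.liftQ col le_rfl) := by
    rw [← LinearMap.ker_eq_bot]
    exact Submodule.ker_liftQ_eq_bot _ _ _ le_rfl
  have h1 : Module.rank R (M ⧸ K) ≤ 1 := by
    have h := LinearMap.lift_rank_le_of_injective _ hinj
    rwa [Module.rank_self, Cardinal.lift_one, Cardinal.lift_le_one_iff] at h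
  set N' : Submodule R (M ⧸ K) := N.map K.mkQ with hN'
  have h2 : Module.rank R ((M ⧸ K) ⧸ N') + Module.rank R N' = Module.rank R (M ⧸ K) :=
    Submodule.rank_quotient_add_rank N'
  rw [(Submodule.quotientQuotientEquivQuotient K N hKN).rank_eq, hrk] at h2
  have h0 : Module.rank R N' = 0 := by
    have hle : 1 + Module.rank R N' ≤ 1 := h2.le.trans h1
    obtain ⟨n, hn⟩ := Cardinal.lt_aleph0.mp
      (lt_of_le_of_lt (le_trans (self_le_add_left _ _) hle) Cardinal.one_lt_aleph0)
    rw [hn] at hle ⊢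
    norm_cast at hle ⊢
    omega
  rw [rank_eq_zero_iff] at h0
  intro x hx
  obtain ⟨a, ha0, ha⟩ := h0 ⟨K.mkQ x, Submodule.mem_map_of_mem hx⟩
  have ha' : a • K.mkQ x = 0 := by simpa using congrArg Subtype.val ha
  rw [← map_smul, Submodule.mkQ_apply, Submodule.Quotient.mk_eq_zero, hK, LinearMap.mem_ker, map_smul,
    smul_eq_mul] at ha'
  exact (mul_eq_zero.mp ha').resolve_left ha0

/-- **Choice-freeness for functionals with kernel INSIDE `N`** (`M` f.g., `M ⧸ N` torsion-free of rank one): for `ψ₁, ψ₂ : M → Λ`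
with `ker ψᵢ ≤ N`, each with SOME value outside `(p)`, and any `m`: `ψ₁ m ∉ (p) ↔ ψ₂ m ∉ (p)` (§3 upgrades `ker ≤ N` to `ker = N`,
then `notMem_augIdealP_iff_of_normalised`). [cite: BourbakiAC5to7, Ch. VII §4 nos. 1–2] -/
theorem notMem_augIdealP_iff_of_ker_le {p : ℕ} [Fact p.Prime]
    {M : Type*} [AddCommGroup M] [Module (IwasawaAlgebra p) M] [Module.Finite (IwasawaAlgebra p) M]
    (N : Submodule (IwasawaAlgebra p) M) [Module.IsTorsionFree (IwasawaAlgebra p) (M ⧸ N)]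
    (hrk : Module.rank (IwasawaAlgebra p) (M ⧸ N) = 1)
    (ψ₁ ψ₂ : M →ₗ[IwasawaAlgebra p] IwasawaAlgebra p)
    (h₁ : ∀ x : M, ψ₁ x = 0 → x ∈ N) (h₁' : ∃ x : M, ψ₁ x ∉ IwasawaAlgebra.augIdealP p)
    (h₂ : ∀ x : M, ψ₂ x = 0 → x ∈ N) (h₂' : ∃ x : M, ψ₂ x ∉ IwasawaAlgebra.augIdealP p) (m : M) :
    ψ₁ m ∉ IwasawaAlgebra.augIdealP p ↔ ψ₂ m ∉ IwasawaAlgebra.augIdealP p :=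
  notMem_augIdealP_iff_of_normalised N hrk ψ₁ ψ₂
    (apply_eq_zero_of_mem_of_ker_le_of_rank_quotient_eq_one N hrk ψ₁ h₁) h₁'
    (apply_eq_zero_of_mem_of_ker_le_of_rank_quotient_eq_one N hrk ψ₂ h₂) h₂' m

/-- **On the pinned carriers (modulo the structure fact alone): a functional `col : 𝐇¹_{loc,Γ}(T_pW) → Λ` with
`ker col ≤ range(𝐇¹_{loc,Γ}(F⁺T) → 𝐇¹_{loc,Γ}(T))` KILLS that range** — the `∃ col, ker col ≤ range …` texts of the line are
exact-kernel texts. [cite: Kato2004Asterisque, Prop. 17.11 (p. 277)] [cite: BourbakiAC5to7, Ch. VII §4 no. 1] -/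
theorem ordinaryKernelFunctional_apply_ordinaryInclusion_eq_zero_of_ker_le
    (hQ : localIwasawaH1_ordinaryQuotient_isTorsionFree_rank_eq_one)
    {p : ℕ} [Fact p.Prime] (W : WeierstrassCurve ℚ) [W.IsElliptic] [W.IsGloballyMinimal]
    [ContinuousSMul ℤ_[p] (W.tateModule p)]
    {κ : ZpExtension ℚ p} {v : HeightOneSpectrum (𝓞 ℚ)} {γᵥ : absoluteGaloisGroup (v.adicCompletion ℚ)}
    (hκ : κ.IsCyclotomic) (hv : ((p : ℕ) : 𝓞 ℚ) ∈ v.asIdeal) (hord : IsOrdinaryAt W p)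
    (hγᵥ : κ.IsTopGenerator (resGalOfEmb (closureEmb (K := ℚ) (v.adicCompletion ℚ)) γᵥ))
    (J : LocalIwasawaH1Data κ v ((tateRep W p).toLocal v) γᵥ)
    (J' : LocalIwasawaH1Data κ v (tateLocalOrdinaryRep W p v) γᵥ)
    (col : J.H →ₗ[IwasawaAlgebra p] IwasawaAlgebra p)
    (hker : ∀ x : J.H, col x = 0 → x ∈ LinearMap.range (J'.ordinaryInclusion J)) (y : J'.H) :
    col (J'.ordinaryInclusion J y) = 0 := by
  obtain ⟨-, hrk⟩ := hQ p W κ v γᵥ hκ hv hord hγᵥ J J'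
  exact apply_eq_zero_of_mem_of_ker_le_of_rank_quotient_eq_one _ hrk col hker _ ⟨y, rfl⟩

/-- **«`col x ∉ (p)`» does not depend on the functional — `ker ≤ range` version** (modulo (12.2.3) and the structure fact): for any
two `Λ`-linear `col₁, col₂ : 𝐇¹_{loc,Γ}(T_pW) → Λ` with `ker colᵢ ≤ range(𝐇¹_{loc,Γ}(F⁺T))`, each with some value outside `(p)`, and
every class `x`: `col₁ x ∉ (p) ↔ col₂ x ∉ (p)` — the `∃ col` value texts V∓ (p727025) and the `∀ col` registered texts V♭∓ agree
modulo the two facts. [cite: Kato2004Asterisque, Prop. 17.11 (p. 277)] [cite: BourbakiAC5to7, Ch. VII §4 nos. 1–2] -/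
theorem ordinaryKernelFunctional_notMem_iff_of_ker_le_of_moduleFinite_of_ordinaryQuotientRank
    (hfin : localIwasawaH1_tateRep_moduleFinite)
    (hQ : localIwasawaH1_ordinaryQuotient_isTorsionFree_rank_eq_one)
    {p : ℕ} [Fact p.Prime] (W : WeierstrassCurve ℚ) [W.IsElliptic] [W.IsGloballyMinimal]
    [ContinuousSMul ℤ_[p] (W.tateModule p)]
    {κ : ZpExtension ℚ p} {v : HeightOneSpectrum (𝓞 ℚ)} {γᵥ : absoluteGaloisGroup (v.adicCompletion ℚ)}
    (hκ : κ.IsCyclotomic) (hv : ((p : ℕ) : 𝓞 ℚ) ∈ v.asIdeal) (hord : IsOrdinaryAt W p)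
    (hγᵥ : κ.IsTopGenerator (resGalOfEmb (closureEmb (K := ℚ) (v.adicCompletion ℚ)) γᵥ))
    (J : LocalIwasawaH1Data κ v ((tateRep W p).toLocal v) γᵥ)
    (J' : LocalIwasawaH1Data κ v (tateLocalOrdinaryRep W p v) γᵥ)
    (col₁ col₂ : J.H →ₗ[IwasawaAlgebra p] IwasawaAlgebra p)
    (h₁ : ∀ x : J.H, col₁ x = 0 → x ∈ LinearMap.range (J'.ordinaryInclusion J))
    (h₁' : ∃ x : J.H, col₁ x ∉ IwasawaAlgebra.augIdealP p)
    (h₂ : ∀ x : J.H, col₂ x = 0 → x ∈ LinearMap.range (J'.ordinaryInclusion J))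
    (h₂' : ∃ x : J.H, col₂ x ∉ IwasawaAlgebra.augIdealP p) (x : J.H) :
    col₁ x ∉ IwasawaAlgebra.augIdealP p ↔ col₂ x ∉ IwasawaAlgebra.augIdealP p := by
  haveI := hfin W p κ v γᵥ hκ hv hγᵥ J
  obtain ⟨htf, hrk⟩ := hQ p W κ v γᵥ hκ hv hord hγᵥ J J'
  haveI := htf
  exact notMem_augIdealP_iff_of_ker_le (LinearMap.range (J'.ordinaryInclusion J)) hrk col₁ col₂ h₁ h₁' h₂ h₂' x

end Literature.NumberTheory.EllipticCurves.Kato2004
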